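import Literature.MathematicalPhysics.QuantumFieldTheory.Balaban1983to89.B12Eq46
import Literature.Analysis.Calculus.IteratedFDerivSymmetric
import Mathlib.Analysis.Analytic.IteratedFDeriv
import Mathlib.Analysis.Calculus.ContDiff.Operations

/-!
# Bałaban, *Renormalization group approach to lattice gauge field theories. I* (CMP 109, 1987) [Balaban1987RG1], (4.6) p. 282 and
# (4.20) p. 285 for the ACTUAL Fréchet derivatives `δⁿ𝐄/δBⁿ = Dⁿ𝐄(b₀)`: the symmetry hypothesis of `B12Eq46` DISCHARGED (Schwarz)

HONEST FRAMING (cell `lit-balaban`, verbatim): statement-level skeleton of published theorems with citation tags; proofs where landed;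
nothing here is a claim about the Yang–Mills mass gap.

PDF held: `paper:balaban1987-cmp109-rg-i-small-field` (journal page = PDF page + 248); pp. 282, 284, 285 [PDF 34, 36, 37] re-read by this
seat in the held text layer (`lit read … --pages 34-37`, 2026-08-21): p. 282 l. 23 «It is a simple polynomial in B, and the differentiation
yields … (4.6)», p. 284 «The group G is semisimple, hence … (δ/δB)𝐄(1) = 0. (4.14) This equality simplifies the identities, and also the sum
(4.6), we can drop the term with n = 1.», p. 285 «We begin the analysis of (4.6) introducing simpler notations. We drop the superscript (j) in
(4.6), and denote δⁿ𝐄^{(j)}(X, U_j(□₀,1))/δBⁿ = 𝐄^{(n)}(X), or simply 𝐄^{(n)}, (4.19) … (4.6) = Σ_{n=2}^{4} (1/(n−1)!) ⟨𝐄^{(n)}, δB,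
⊗^{n−1} B⟩. (4.20)».

WHAT IS REPRODUCED: SKELETON rows **B12.Eq4.6** (owner r20: `B12Eq46`, p243948 + v1.1 p245425, head «proved … symmetry of δⁿ𝐄/δBⁿ
carried as hypothesis»), the (4.6) + (4.14) ⇒ **(4.20)** link of row B12.Eq4.19-4.20, and the tie to the (3.34) Taylor polynomial of row
B12.Eq3.33-3.34 (r09 `B12Taylor334.taylor334`: `Σ_{n<5} (n!)⁻¹ • iteratedFDeriv ℝ n f 0 (fun _ => B)`).
`B12Eq46` proves (4.6)/(4.20) for the Taylor polynomial `taylorPoly4 p` of an ABSTRACT formal multilinear series `p` whose terms of every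
order are assumed SYMMETRIC (`hsymm`); its header records why: «in print it holds because `p n` is an `n`-th Fréchet derivative (Schwarz);
Mathlib currently provides the symmetry of iterated derivatives at order 2 only».  Both the tree and Mathlib now have the all-orders
statement: `Literature.Analysis.Calculus.iteratedFDeriv_comp_perm_of_le` (maps of class `Cⁿ`, orders `m ≤ n`; [Dieudonne1960] (8.12.4))
and Mathlib `ContDiffAt.iteratedFDeriv_comp_perm` (analytic maps, `C^ω`, every order).  THIS FILE feeds them in: (4.6) and (4.20) hold for
the Taylor polynomial built from the ACTUAL derivatives `p n := Dⁿ𝐄(b₀) = iteratedFDeriv ℝ n 𝐄 b₀` of any map `𝐄` of class `C⁴` at the base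
point `b₀` (`= U_j(□₀, 1)`, i.e. `B = 0` in (3.34)) — in particular of the analytic `𝐄^{(j)}(X, U_j(□₀, exp iB))` of (3.33) — with NO
symmetry hypothesis, and (4.14) enters in its printed form `(δ/δB)𝐄(1) = 0`, i.e. `fderiv ℝ 𝐄 b₀ = 0`.

WHAT IS CERTIFIED (kernel, sorry-free; axioms standard; theorems only — no definition, no new named fact), over real normed spaces
`E` (fields `B`), `F` (values), `EA` (fields 𝐀) exactly as in `B12Eq46`:
* §1 `exists_trunc`, `taylorPoly4_eq_of_trunc`, **`hsymm_of_trunc`** — a formal multilinear series agreeing with `Dⁿf(b₀)` for `n ≤ 4`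
  (zero above) has `taylorPoly4 = Σ_{n≤4} (1/n!) Dⁿf(b₀)[B,…,B]` and satisfies `B12Eq46`'s `hsymm` at EVERY order when `f` is `C⁴` at `b₀`
  (Schwarz: `iteratedFDeriv_comp_perm_of_le`); `hsymm_ftaylorSeries` — Mathlib's full `ftaylorSeries ℝ f b₀` satisfies it when `f` is
  `C^ω` at `b₀` (`ContDiffAt.iteratedFDeriv_comp_perm`), `taylorPoly4_ftaylorSeries`.
* §2 **`hasDerivAt_taylorSum`** — `B12Eq46.hasDerivAt_taylorPoly4` for the actual derivatives: along any curve `B(τ)` with `B(0) = B₀`,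
  `B′(0) = δB`, `(d/dτ)|₀ Σ_{n≤4} (1/n!) Dⁿf(b₀)[⊗ⁿB(τ)] = Σ_{n=1}^{4} (1/(n−1)!) Dⁿf(b₀)[δB, ⊗^{n−1}B₀]` (index written `n ↦ n+1`), `f`
  of class `C⁴` at `b₀`; `deriv_taylorSum`.
* §3 **`eq46_of_contDiffAt`** / `eq46_deriv_of_contDiffAt` — THE DISPLAY (4.6) with `p n = Dⁿf(b₀)`, the curve `τ ↦ Q(ηΛ(x + τv))` and
  `δB = ⟨(δQ/δA)(ηΛ(x)), η⟨(δΛ/δ𝐀)(x), v⟩⟩` of `B12Eq46.hasDerivAt_deltaB` (BY NAME), hypothesis `ContDiffAt ℝ 4 f b₀` only;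
  `eq46_of_contDiffAt_omega` (via `ftaylorSeries`, `C^ω`), **`eq46_of_analyticAt`** (`f` complex-analytic at `b₀` on complex spaces, read over
  `ℝ` — the printed situation: «𝐄^{(j)} … analytic», p. 277/281).
* §4 **`eq420_of_fderiv_eq_zero`** / `eq420_deriv_of_fderiv_eq_zero` — (4.14) `fderiv ℝ f b₀ = 0` ⇒ (4.20): the derivative (4.6) equals
  `Σ_{n=2}^{4} (1/(n−1)!) Dⁿf(b₀)[δB, ⊗^{n−1}B]` (`Finset.Ico 1 4` in the shifted index), from `B12Eq46.eq420_of_eq414` with `p 1 = 0`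
  read off `fderiv = 0` (`iteratedFDeriv_one_eq_zero`).
* §5 **`eq46_taylor334`** / `eq420_taylor334` — the same at the base point `b₀ = 0` under the hypotheses of r09's (3.34) `B12Taylor334.taylor334`
  (`f` of class `C⁵` on an open `s ∋ 0`): the `t_□`-derivative of the (3.34) Taylor polynomial is the (4.6)/(4.20) sum.
MODELLING / HONEST SCOPE.  As in `B12Eq46`: abstract real normed carriers; the localisation factors `ζ̃_□`, `ζ_□` absorbed in `x`, `v`, `Q`;
«localized in □» not modelled; the semisimplicity argument behind (4.14) is row B12.Eq4.13-4.14 (`B12Semisimple414`, `B12GaugeInv47`) and is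
NOT re-derived — (4.14) is the hypothesis `fderiv ℝ f b₀ = 0`.  Mega-formalization `lit-balaban`, HOME `run/shared/lean/pub/lit-balaban/`,
Phase-2 proof seat p05 gen 8 (unit `lit-balaban-p05`, free-target protocol G.5-34(d)).  Imports `…B12Eq46` (r20) and
`Literature.Analysis.Calculus.IteratedFDerivSymmetric` BY NAME; modifies nothing there.
-/

noncomputable section

open Filter Finset
open scoped Topology BigOperators Nat ContDiff

namespace Literature.MathematicalPhysics.QuantumFieldTheory.Balaban1983to89.B12Eq46Frechet

open Literature.MathematicalPhysics.QuantumFieldTheory.Balaban1983to89 B12Eq46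
open Literature.Analysis.Calculus

section Real

variable {E F : Type*} [NormedAddCommGroup E] [NormedSpace ℝ E] [NormedAddCommGroup F] [NormedSpace ℝ F]

/-! ## §1. The Taylor data of an actual map: truncated series, its Taylor polynomial, Schwarz symmetry -/

/-- A formal multilinear series carrying the derivatives `Dⁿf(b₀)` for `n ≤ 4` and nothing above (the data the Taylor polynomial of (3.34)
uses). [cite: Balaban1987RG1, (3.34) p.277; (4.19) p.285] -/
theorem exists_trunc (f : E → F) (b₀ : E) :
    ∃ p : FormalMultilinearSeries ℝ E F, (∀ n, n < 5 → p n = iteratedFDeriv ℝ n f b₀) ∧ ∀ n, 5 ≤ n → p n = 0 := by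
  classical
  exact ⟨fun n => if n < 5 then iteratedFDeriv ℝ n f b₀ else 0, fun n hn => if_pos hn, fun n hn => if_neg (by omega)⟩

/-- For such a series the «sum over n» of p. 282 is the (3.34) Taylor polynomial `Σ_{n=0}^{4} (1/n!) ⟨Dⁿf(b₀), ⊗ⁿB⟩`.
[cite: Balaban1987RG1, (3.34) p.277; (4.6) p.282] -/
theorem taylorPoly4_eq_of_trunc {f : E → F} {b₀ : E} {p : FormalMultilinearSeries ℝ E F}
    (hp : ∀ n, n < 5 → p n = iteratedFDeriv ℝ n f b₀) (B : E) :
    taylorPoly4 p B = ∑ n ∈ Finset.range 5, ((n ! : ℝ)⁻¹) • iteratedFDeriv ℝ n f b₀ (fun _ => B) := by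
  unfold taylorPoly4
  refine Finset.sum_congr rfl fun n hn => ?_
  rw [hp n (Finset.mem_range.mp hn)]

/-- **Schwarz symmetry feeds `B12Eq46`'s hypothesis**: if `f` is of class `C⁴` at `b₀`, a series agreeing with `Dⁿf(b₀)` for `n ≤ 4` and
vanishing above satisfies `hsymm` at every order (orders `≤ 4`: `Literature.Analysis.Calculus.iteratedFDeriv_comp_perm_of_le`; above: `0`).
[cite: Balaban1987RG1, (4.6) p.282; (4.19) p.285] -/
theorem hsymm_of_trunc {f : E → F} {b₀ : E} (hf : ContDiffAt ℝ 4 f b₀) {p : FormalMultilinearSeries ℝ E F}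
    (hp : ∀ n, n < 5 → p n = iteratedFDeriv ℝ n f b₀) (hp' : ∀ n, 5 ≤ n → p n = 0) :
    ∀ (n : ℕ) (σ : Equiv.Perm (Fin (n + 1))) (w : Fin (n + 1) → E), p (n + 1) (w ∘ σ) = p (n + 1) w := by
  intro n σ w
  by_cases hn : n + 1 < 5
  · rw [hp (n + 1) hn]
    exact iteratedFDeriv_comp_perm_of_le hf (by exact_mod_cast (by omega : n + 1 ≤ 4)) w σ
  · rw [hp' (n + 1) (by omega)]
    simp

/-- Mathlib's full formal Taylor series `ftaylorSeries ℝ f b₀ = (Dⁿf(b₀))_n` satisfies `hsymm` at EVERY order when `f` is `C^ω` at `b₀`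
(Mathlib `ContDiffAt.iteratedFDeriv_comp_perm`). [cite: Balaban1987RG1, (4.6) p.282; (1.18) p.263] -/
theorem hsymm_ftaylorSeries {f : E → F} {b₀ : E} (hf : ContDiffAt ℝ ω f b₀) :
    ∀ (n : ℕ) (σ : Equiv.Perm (Fin (n + 1))) (w : Fin (n + 1) → E),
      ftaylorSeries ℝ f b₀ (n + 1) (w ∘ σ) = ftaylorSeries ℝ f b₀ (n + 1) w :=
  fun _ σ w => hf.iteratedFDeriv_comp_perm w σ

/-- `taylorPoly4` of the full Taylor series is the (3.34) Taylor polynomial. [cite: Balaban1987RG1, (3.34) p.277; (4.6) p.282] -/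
theorem taylorPoly4_ftaylorSeries (f : E → F) (b₀ B : E) :
    taylorPoly4 (ftaylorSeries ℝ f b₀) B = ∑ n ∈ Finset.range 5, ((n ! : ℝ)⁻¹) • iteratedFDeriv ℝ n f b₀ (fun _ => B) :=
  taylorPoly4_eq_of_trunc (fun _ _ => rfl) B

/-! ## §2. (4.6), the differentiated «sum over n», for the actual derivatives along any curve -/

/-- **`B12Eq46.hasDerivAt_taylorPoly4` with the symmetry DISCHARGED**: for `f` of class `C⁴` at `b₀` and a curve `B(τ)` with `B(0) = B₀`,
`B′(0) = δB`: `(d/dτ)|₀ Σ_{n=0}^{4} (1/n!) Dⁿf(b₀)[⊗ⁿ B(τ)] = Σ_{n=1}^{4} (1/(n−1)!) Dⁿf(b₀)[δB, ⊗^{n−1} B₀]` (right member written with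
`n ↦ n+1`). [cite: Balaban1987RG1, (4.6) p.282] -/
theorem hasDerivAt_taylorSum {f : E → F} {b₀ : E} (hf : ContDiffAt ℝ 4 f b₀) {B : ℝ → E} {B₀ δB : E}
    (hB : HasDerivAt B δB 0) (hB₀ : B 0 = B₀) :
    HasDerivAt (fun s => ∑ n ∈ Finset.range 5, ((n ! : ℝ)⁻¹) • iteratedFDeriv ℝ n f b₀ (fun _ => B s))
      (∑ n ∈ Finset.range 4, ((n ! : ℝ)⁻¹) •
        iteratedFDeriv ℝ (n + 1) f b₀ (Function.update (fun _ : Fin (n + 1) => B₀) 0 δB)) 0 := by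
  obtain ⟨p, hp, hp'⟩ := exists_trunc f b₀
  have h := hasDerivAt_taylorPoly4 p (hsymm_of_trunc hf hp hp') hB hB₀
  have hl : (fun s => taylorPoly4 p (B s)) =
      fun s => ∑ n ∈ Finset.range 5, ((n ! : ℝ)⁻¹) • iteratedFDeriv ℝ n f b₀ (fun _ => B s) := by
    funext s; exact taylorPoly4_eq_of_trunc hp (B s)
  have hr : ∑ n ∈ Finset.range 4, ((n ! : ℝ)⁻¹) • p (n + 1) (Function.update (fun _ : Fin (n + 1) => B₀) 0 δB) =
      ∑ n ∈ Finset.range 4, ((n ! : ℝ)⁻¹) •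
        iteratedFDeriv ℝ (n + 1) f b₀ (Function.update (fun _ : Fin (n + 1) => B₀) 0 δB) :=
    Finset.sum_congr rfl fun n hn => by rw [hp (n + 1) (by have := Finset.mem_range.mp hn; omega)]
  rw [hl, hr] at h
  exact h

/-- `deriv` form of `hasDerivAt_taylorSum`. [cite: Balaban1987RG1, (4.6) p.282] -/
theorem deriv_taylorSum {f : E → F} {b₀ : E} (hf : ContDiffAt ℝ 4 f b₀) {B : ℝ → E} {B₀ δB : E}
    (hB : HasDerivAt B δB 0) (hB₀ : B 0 = B₀) :
    deriv (fun s => ∑ n ∈ Finset.range 5, ((n ! : ℝ)⁻¹) • iteratedFDeriv ℝ n f b₀ (fun _ => B s)) 0 =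
      ∑ n ∈ Finset.range 4, ((n ! : ℝ)⁻¹) •
        iteratedFDeriv ℝ (n + 1) f b₀ (Function.update (fun _ : Fin (n + 1) => B₀) 0 δB) :=
  (hasDerivAt_taylorSum hf hB hB₀).deriv

/-! ## §3. The display (4.6) for the actual derivatives -/

section Assembled

variable {EA : Type*} [NormedAddCommGroup EA] [NormedSpace ℝ EA]

/-- **(4.6) p. 282 with `p n = Dⁿf(b₀)` and NO symmetry hypothesis**: for `f` (`= B ↦ 𝐄^{(j)}(X, U_j(□₀, exp iB))`) of class `C⁴` at
`b₀` (`= the point B = 0`, `U_j(□₀,1)`), `Q` (`= Q_j(η·)`) differentiable at `ηΛ(x)`, `Λ` differentiable at `x`, `𝐀(t_□) = x + t_□v`: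
`(∂/∂t_□)|₀ Σ_{n=0}^{4} (1/n!) ⟨Dⁿf(b₀), ⊗ⁿ Q(ηΛ(𝐀(t_□)))⟩ = Σ_{n=1}^{4} (1/(n−1)!) ⟨Dⁿf(b₀), δB, ⊗^{n−1} B⟩`, `B = Q(ηΛ(x))`,
`δB = ⟨(δQ/δA)(ηΛ(x)), η⟨(δΛ/δ𝐀)(x), v⟩⟩` (`B12Eq46.hasDerivAt_deltaB`). [cite: Balaban1987RG1, (4.6) p.282] -/
theorem eq46_of_contDiffAt {f : E → F} {b₀ : E} (hf : ContDiffAt ℝ 4 f b₀)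
    {Q : EA → E} {Λ : EA → EA} {η : ℝ} {x : EA} (v : EA)
    (hQ : DifferentiableAt ℝ Q (η • Λ x)) (hΛ : DifferentiableAt ℝ Λ x) :
    HasDerivAt (fun τ : ℝ => ∑ n ∈ Finset.range 5, ((n ! : ℝ)⁻¹) • iteratedFDeriv ℝ n f b₀ (fun _ => Q (η • Λ (x + τ • v))))
      (∑ n ∈ Finset.range 4, ((n ! : ℝ)⁻¹) •
        iteratedFDeriv ℝ (n + 1) f b₀ (Function.update (fun _ : Fin (n + 1) => Q (η • Λ x)) 0
          (fderiv ℝ Q (η • Λ x) (η • fderiv ℝ Λ x v)))) 0 :=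
  hasDerivAt_taylorSum hf (hasDerivAt_deltaB v hQ hΛ) (by simp)

/-- `deriv` form of (4.6) for the actual derivatives. [cite: Balaban1987RG1, (4.6) p.282] -/
theorem eq46_deriv_of_contDiffAt {f : E → F} {b₀ : E} (hf : ContDiffAt ℝ 4 f b₀)
    {Q : EA → E} {Λ : EA → EA} {η : ℝ} {x : EA} (v : EA)
    (hQ : DifferentiableAt ℝ Q (η • Λ x)) (hΛ : DifferentiableAt ℝ Λ x) :
    deriv (fun τ : ℝ => ∑ n ∈ Finset.range 5, ((n ! : ℝ)⁻¹) • iteratedFDeriv ℝ n f b₀ (fun _ => Q (η • Λ (x + τ • v)))) 0 =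
      ∑ n ∈ Finset.range 4, ((n ! : ℝ)⁻¹) •
        iteratedFDeriv ℝ (n + 1) f b₀ (Function.update (fun _ : Fin (n + 1) => Q (η • Λ x)) 0
          (fderiv ℝ Q (η • Λ x) (η • fderiv ℝ Λ x v))) :=
  (eq46_of_contDiffAt hf v hQ hΛ).deriv

/-- (4.6) for `B12Eq46`'s own object `taylorPoly4` of Mathlib's full Taylor series `ftaylorSeries ℝ f b₀`, `f` of class `C^ω` at `b₀`
(symmetry at every order from Mathlib). [cite: Balaban1987RG1, (4.6) p.282; (1.18) p.263] -/
theorem eq46_of_contDiffAt_omega {f : E → F} {b₀ : E} (hf : ContDiffAt ℝ ω f b₀)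
    {Q : EA → E} {Λ : EA → EA} {η : ℝ} {x : EA} (v : EA)
    (hQ : DifferentiableAt ℝ Q (η • Λ x)) (hΛ : DifferentiableAt ℝ Λ x) :
    HasDerivAt (fun τ : ℝ => taylorPoly4 (ftaylorSeries ℝ f b₀) (Q (η • Λ (x + τ • v))))
      (∑ n ∈ Finset.range 4, ((n ! : ℝ)⁻¹) •
        iteratedFDeriv ℝ (n + 1) f b₀ (Function.update (fun _ : Fin (n + 1) => Q (η • Λ x)) 0
          (fderiv ℝ Q (η • Λ x) (η • fderiv ℝ Λ x v)))) 0 :=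
  eq46 (ftaylorSeries ℝ f b₀) (hsymm_ftaylorSeries hf) v hQ hΛ

end Assembled

/-! ## §4. (4.14) ⇒ (4.20): «we can drop the term with n = 1» -/

/-- (4.14) in the language of `B12Eq46`: `(δ/δB)𝐄(1) = 0`, i.e. `fderiv ℝ f b₀ = 0`, is `D¹f(b₀) = 0`. [cite: Balaban1987RG1, (4.14) p.284] -/
theorem iteratedFDeriv_one_eq_zero {f : E → F} {b₀ : E} (h414 : fderiv ℝ f b₀ = 0) : iteratedFDeriv ℝ 1 f b₀ = 0 := by
  ext m
  rw [iteratedFDeriv_one_apply, h414]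
  simp

section Eq420

variable {EA : Type*} [NormedAddCommGroup EA] [NormedSpace ℝ EA]

/-- **(4.20) p. 285 from (4.6) and (4.14), for the actual derivatives**: `f` of class `C⁴` at `b₀` with `(δ/δB)f(b₀) = 0` ((4.14): «G is
semisimple, hence (δ/δB)𝐄(1) = 0 … we can drop the term with n = 1») ⇒ the derivative (4.6) equals
`Σ_{n=2}^{4} (1/(n−1)!) ⟨Dⁿf(b₀), δB, ⊗^{n−1}B⟩` = «(4.6) = Σ_{n=2}^{4} (1/(n−1)!) ⟨𝐄^{(n)}, δB, ⊗^{n−1}B⟩ (4.20)» with `𝐄^{(n)} = Dⁿf(b₀)`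
((4.19)); shifted index `n+1 ∈ {2,3,4}`, i.e. `n ∈ Finset.Ico 1 4`. [cite: Balaban1987RG1, (4.19)–(4.20) p.285; (4.14) p.284; (4.6) p.282] -/
theorem eq420_of_fderiv_eq_zero {f : E → F} {b₀ : E} (hf : ContDiffAt ℝ 4 f b₀) (h414 : fderiv ℝ f b₀ = 0)
    {Q : EA → E} {Λ : EA → EA} {η : ℝ} {x : EA} (v : EA)
    (hQ : DifferentiableAt ℝ Q (η • Λ x)) (hΛ : DifferentiableAt ℝ Λ x) :
    HasDerivAt (fun τ : ℝ => ∑ n ∈ Finset.range 5, ((n ! : ℝ)⁻¹) • iteratedFDeriv ℝ n f b₀ (fun _ => Q (η • Λ (x + τ • v))))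
      (∑ n ∈ Finset.Ico 1 4, ((n ! : ℝ)⁻¹) •
        iteratedFDeriv ℝ (n + 1) f b₀ (Function.update (fun _ : Fin (n + 1) => Q (η • Λ x)) 0
          (fderiv ℝ Q (η • Λ x) (η • fderiv ℝ Λ x v)))) 0 := by
  obtain ⟨p, hp, hp'⟩ := exists_trunc f b₀
  have h1 : p 1 = 0 := by rw [hp 1 (by norm_num)]; exact iteratedFDeriv_one_eq_zero h414
  have h := eq420_of_eq414 p (hsymm_of_trunc hf hp hp') h1 v hQ hΛ
  have hl : (fun τ : ℝ => taylorPoly4 p (Q (η • Λ (x + τ • v)))) =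
      fun τ => ∑ n ∈ Finset.range 5, ((n ! : ℝ)⁻¹) • iteratedFDeriv ℝ n f b₀ (fun _ => Q (η • Λ (x + τ • v))) := by
    funext τ; exact taylorPoly4_eq_of_trunc hp _
  have hr : ∑ n ∈ Finset.Ico 1 4, ((n ! : ℝ)⁻¹) •
        p (n + 1) (Function.update (fun _ : Fin (n + 1) => Q (η • Λ x)) 0 (fderiv ℝ Q (η • Λ x) (η • fderiv ℝ Λ x v))) =
      ∑ n ∈ Finset.Ico 1 4, ((n ! : ℝ)⁻¹) •
        iteratedFDeriv ℝ (n + 1) f b₀ (Function.update (fun _ : Fin (n + 1) => Q (η • Λ x)) 0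
          (fderiv ℝ Q (η • Λ x) (η • fderiv ℝ Λ x v))) :=
    Finset.sum_congr rfl fun n hn => by rw [hp (n + 1) (by have := (Finset.mem_Ico.mp hn).2; omega)]
  rw [hl, hr] at h
  exact h

/-- `deriv` form of (4.20) for the actual derivatives. [cite: Balaban1987RG1, (4.20) p.285; (4.14) p.284] -/
theorem eq420_deriv_of_fderiv_eq_zero {f : E → F} {b₀ : E} (hf : ContDiffAt ℝ 4 f b₀) (h414 : fderiv ℝ f b₀ = 0)
    {Q : EA → E} {Λ : EA → EA} {η : ℝ} {x : EA} (v : EA)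
    (hQ : DifferentiableAt ℝ Q (η • Λ x)) (hΛ : DifferentiableAt ℝ Λ x) :
    deriv (fun τ : ℝ => ∑ n ∈ Finset.range 5, ((n ! : ℝ)⁻¹) • iteratedFDeriv ℝ n f b₀ (fun _ => Q (η • Λ (x + τ • v)))) 0 =
      ∑ n ∈ Finset.Ico 1 4, ((n ! : ℝ)⁻¹) •
        iteratedFDeriv ℝ (n + 1) f b₀ (Function.update (fun _ : Fin (n + 1) => Q (η • Λ x)) 0
          (fderiv ℝ Q (η • Λ x) (η • fderiv ℝ Λ x v))) :=
  (eq420_of_fderiv_eq_zero hf h414 v hQ hΛ).deriv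

/-- The three terms of (4.20) written out for the actual derivatives: `D²f(b₀)[δB,B] + ½ D³f(b₀)[δB,B,B] + ⅙ D⁴f(b₀)[δB,B,B,B]`
(`B12Eq46.sum420_three_terms`). [cite: Balaban1987RG1, (4.20) p.285] -/
theorem eq420_deriv_three_terms {f : E → F} {b₀ : E} (hf : ContDiffAt ℝ 4 f b₀) (h414 : fderiv ℝ f b₀ = 0)
    {Q : EA → E} {Λ : EA → EA} {η : ℝ} {x : EA} (v : EA)
    (hQ : DifferentiableAt ℝ Q (η • Λ x)) (hΛ : DifferentiableAt ℝ Λ x) :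
    deriv (fun τ : ℝ => ∑ n ∈ Finset.range 5, ((n ! : ℝ)⁻¹) • iteratedFDeriv ℝ n f b₀ (fun _ => Q (η • Λ (x + τ • v)))) 0 =
      iteratedFDeriv ℝ 2 f b₀ (Function.update (fun _ : Fin 2 => Q (η • Λ x)) 0 (fderiv ℝ Q (η • Λ x) (η • fderiv ℝ Λ x v)))
      + (2 : ℝ)⁻¹ • iteratedFDeriv ℝ 3 f b₀
          (Function.update (fun _ : Fin 3 => Q (η • Λ x)) 0 (fderiv ℝ Q (η • Λ x) (η • fderiv ℝ Λ x v)))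
      + (6 : ℝ)⁻¹ • iteratedFDeriv ℝ 4 f b₀
          (Function.update (fun _ : Fin 4 => Q (η • Λ x)) 0 (fderiv ℝ Q (η • Λ x) (η • fderiv ℝ Λ x v))) := by
  rw [eq420_deriv_of_fderiv_eq_zero hf h414 v hQ hΛ,
    sum420_three_terms (fun n => iteratedFDeriv ℝ (n + 1) f b₀
      (Function.update (fun _ : Fin (n + 1) => Q (η • Λ x)) 0 (fderiv ℝ Q (η • Λ x) (η • fderiv ℝ Λ x v))))]

end Eq420

/-! ## §5. At the base point of (3.34): the `t_□`-derivative of r09's Taylor polynomial -/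

section Taylor334

variable {EA : Type*} [NormedAddCommGroup EA] [NormedSpace ℝ EA]

/-- Under the hypotheses of r09's (3.34) `B12Taylor334.taylor334` (`f` of class `C⁵` on an open `s`; here only `0 ∈ s` is used), the
`t_□`-derivative at `0` of the (3.34) Taylor polynomial `Σ_{n=0}^{4} (1/n!) ⟨Dⁿf(0), ⊗ⁿB⟩` evaluated at `B = Q(ηΛ(x + t_□v))` is the
(4.6) sum. [cite: Balaban1987RG1, (3.34) p.277; (4.6) p.282] -/
theorem eq46_taylor334 {s : Set E} (hs : IsOpen s) {f : E → F} (hf : ContDiffOn ℝ 5 f s) (h0 : (0 : E) ∈ s)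
    {Q : EA → E} {Λ : EA → EA} {η : ℝ} {x : EA} (v : EA)
    (hQ : DifferentiableAt ℝ Q (η • Λ x)) (hΛ : DifferentiableAt ℝ Λ x) :
    HasDerivAt (fun τ : ℝ => ∑ n ∈ Finset.range 5, ((n ! : ℝ)⁻¹) • iteratedFDeriv ℝ n f 0 (fun _ => Q (η • Λ (x + τ • v))))
      (∑ n ∈ Finset.range 4, ((n ! : ℝ)⁻¹) •
        iteratedFDeriv ℝ (n + 1) f 0 (Function.update (fun _ : Fin (n + 1) => Q (η • Λ x)) 0
          (fderiv ℝ Q (η • Λ x) (η • fderiv ℝ Λ x v)))) 0 :=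
  eq46_of_contDiffAt ((hf.contDiffAt (hs.mem_nhds h0)).of_le (by norm_num)) v hQ hΛ

/-- The same after (4.14) `(δ/δB)f(0) = 0`: the (4.20) sum. [cite: Balaban1987RG1, (3.34) p.277; (4.14) p.284; (4.20) p.285] -/
theorem eq420_taylor334 {s : Set E} (hs : IsOpen s) {f : E → F} (hf : ContDiffOn ℝ 5 f s) (h0 : (0 : E) ∈ s)
    (h414 : fderiv ℝ f 0 = 0)
    {Q : EA → E} {Λ : EA → EA} {η : ℝ} {x : EA} (v : EA)
    (hQ : DifferentiableAt ℝ Q (η • Λ x)) (hΛ : DifferentiableAt ℝ Λ x) :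
    HasDerivAt (fun τ : ℝ => ∑ n ∈ Finset.range 5, ((n ! : ℝ)⁻¹) • iteratedFDeriv ℝ n f 0 (fun _ => Q (η • Λ (x + τ • v))))
      (∑ n ∈ Finset.Ico 1 4, ((n ! : ℝ)⁻¹) •
        iteratedFDeriv ℝ (n + 1) f 0 (Function.update (fun _ : Fin (n + 1) => Q (η • Λ x)) 0
          (fderiv ℝ Q (η • Λ x) (η • fderiv ℝ Λ x v)))) 0 :=
  eq420_of_fderiv_eq_zero ((hf.contDiffAt (hs.mem_nhds h0)).of_le (by norm_num)) h414 v hQ hΛ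

end Taylor334

end Real

/-! ## §6. The printed situation: `𝐄^{(j)}` complex-analytic, (4.6) read over `ℝ` -/

section Analytic

variable {E F EA : Type*} [NormedAddCommGroup E] [NormedSpace ℝ E] [NormedSpace ℂ E] [IsScalarTower ℝ ℂ E]
  [NormedAddCommGroup F] [NormedSpace ℝ F] [NormedSpace ℂ F] [IsScalarTower ℝ ℂ F] [CompleteSpace F]
  [NormedAddCommGroup EA] [NormedSpace ℝ EA]

/-- A complex-analytic map (values in a complete space, in print `ℂ`) is real-`C^ω` (restriction of scalars), hence real-`C⁴`: the
regularity (4.6) needs, from «𝐄^{(j)}(X, ·) … analytic» ((1.18) p. 263, (4.4) p. 281). [cite: Balaban1987RG1, (1.18) p.263; (4.4) p.281] -/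
theorem contDiffAt_real_of_analyticAt {f : E → F} {b₀ : E} (hf : AnalyticAt ℂ f b₀) : ContDiffAt ℝ ω f b₀ :=
  hf.contDiffAt.restrict_scalars ℝ

/-- **(4.6) in the printed situation**: `f` complex-analytic at `b₀` ⇒ (4.6) for the real Taylor polynomial of the actual derivatives,
no symmetry hypothesis. [cite: Balaban1987RG1, (4.6) p.282; (4.4) p.281] -/
theorem eq46_of_analyticAt {f : E → F} {b₀ : E} (hf : AnalyticAt ℂ f b₀)
    {Q : EA → E} {Λ : EA → EA} {η : ℝ} {x : EA} (v : EA)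
    (hQ : DifferentiableAt ℝ Q (η • Λ x)) (hΛ : DifferentiableAt ℝ Λ x) :
    HasDerivAt (fun τ : ℝ => ∑ n ∈ Finset.range 5, ((n ! : ℝ)⁻¹) • iteratedFDeriv ℝ n f b₀ (fun _ => Q (η • Λ (x + τ • v))))
      (∑ n ∈ Finset.range 4, ((n ! : ℝ)⁻¹) •
        iteratedFDeriv ℝ (n + 1) f b₀ (Function.update (fun _ : Fin (n + 1) => Q (η • Λ x)) 0
          (fderiv ℝ Q (η • Λ x) (η • fderiv ℝ Λ x v)))) 0 :=
  eq46_of_contDiffAt ((contDiffAt_real_of_analyticAt hf).of_le le_top) v hQ hΛ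

/-- **(4.20) in the printed situation**: `f` complex-analytic at `b₀` with `(δ/δB)f(b₀) = 0` (real derivative) ⇒ (4.20).
[cite: Balaban1987RG1, (4.20) p.285; (4.14) p.284] -/
theorem eq420_of_analyticAt {f : E → F} {b₀ : E} (hf : AnalyticAt ℂ f b₀) (h414 : fderiv ℝ f b₀ = 0)
    {Q : EA → E} {Λ : EA → EA} {η : ℝ} {x : EA} (v : EA)
    (hQ : DifferentiableAt ℝ Q (η • Λ x)) (hΛ : DifferentiableAt ℝ Λ x) :
    HasDerivAt (fun τ : ℝ => ∑ n ∈ Finset.range 5, ((n ! : ℝ)⁻¹) • iteratedFDeriv ℝ n f b₀ (fun _ => Q (η • Λ (x + τ • v))))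
      (∑ n ∈ Finset.Ico 1 4, ((n ! : ℝ)⁻¹) •
        iteratedFDeriv ℝ (n + 1) f b₀ (Function.update (fun _ : Fin (n + 1) => Q (η • Λ x)) 0
          (fderiv ℝ Q (η • Λ x) (η • fderiv ℝ Λ x v)))) 0 :=
  eq420_of_fderiv_eq_zero ((contDiffAt_real_of_analyticAt hf).of_le le_top) h414 v hQ hΛ

omit [CompleteSpace F] in
/-- The complex derivative vanishing ((4.14) as a statement about the complex-analytic `𝐄`) gives the real one.
[cite: Balaban1987RG1, (4.14) p.284] -/
theorem fderiv_real_eq_zero_of_fderiv_complex_eq_zero {f : E → F} {b₀ : E} (hf : DifferentiableAt ℂ f b₀)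
    (h414 : fderiv ℂ f b₀ = 0) : fderiv ℝ f b₀ = 0 := by
  rw [hf.fderiv_restrictScalars ℝ, h414]
  rfl

end Analytic

end Literature.MathematicalPhysics.QuantumFieldTheory.Balaban1983to89.B12Eq46Frechet

end
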